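import Summits.CriticalPhenomena.PercolationContinuityZ3.Theorems.PercNearOneGluingAdditiveGluingConeBlockGood
import HarnessLib

/-! # Crux `PercNearOneGluing.AdditiveGluing` (stmt-CriticalPhenomena-4576): **the crux follows from the CONE growth step** (part 2/2: the assembly)

Lead c5 (line `peel`, skeleton v3 `Cruxes/AdditiveGluing/Lines/peel.lean`); lands `--supports stmt-CriticalPhenomena-4576`.
No definitions, no named facts.  CONDITIONAL result: the main theorems take the cone step `hcone` (spelled out in each statement).

`conePeel` (the registered stub `stub_conePeel` of skeleton v3): for a weighting `u`, relays `A ∋ b` with `4 ≤ A.card`, a minimiser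
`a₀` of `μ_u(· ↔ b)` over `A`, a non-empty block `T` of non-relays, a vertex `x ∉ A ∪ T` with all of `T ∪ {x}` bad, and the
induction hypothesis of the skeleton (goodness of every quadruple on a weighting with at most as many positive-degree vertices as
`u`): if `T` is `a₀`-good in block form with the worst selection,
`τ(a₀) + μ(a₀↮b, a₀↔T, T↔b) ≤ μ(T↔b) + Σ_{W ∩ A = ∅} μ(K_T = W)·min_A μ(a ↔ b off W)`, then so is `T ∪ {x}`.
This is the CONE consequence of the ratio step (`pairGamma ∧ goodStaysGood`, `coneLine_of_pairGamma` below), strictly weaker, and it is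
exactly what the peel chain consumes: `coneLine_blockGood` (induction on `|T|` from the point `s`, whose goodness the induction
hypothesis supplies; at most two relays besides `b` directly by the landed drift theorem `blockGood_cardLeThree`),
`coneLine_goodStep` (`goodStep24_main` + un-gluing), `coneLine_good_all`, `coneLine_additiveGluing_of` (KN level sets), and the
registered handle `stub_additiveGluingOfConePeel_c5 : conePeel → AdditiveGluing`.  Numerics of the cone step (lead c5, exact partition
DP, n ≤ 7, designation `argmin τ_u`): 0 violations in 6 152 / 3 840 / 508 instances at `|T| = 1 / 2 / 3`; FALSE at an arbitrary
designation (exact 7-vertex witness with both points good and the pair not), so the minimiser hypothesis is load-bearing.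
[cite: KozmaNitzan2024, §3.2 Definition p. 12, Thms 4–5 pp. 12–14, Lemma 5 p. 13, §5.3 p. 34, Question 7 & 9 p. 36]
-/

namespace Summit.CriticalPhenomena.PercolationContinuityZ3.Theorems

open MeasureTheory Set
open Literature.Probability.LatticeModels (prodBernoulli)
open Literature.Probability.Percolation (BondConfig openConn openConnIn openGraph openCluster)
open scoped BigOperators Classical

noncomputable section

/-- **The inductive step `stub_goodStep` (verbatim) from the cone stub.**  `goodStep24_main`; un-gluing (H3); the residue by
`coneLine_blockGood` fed with the induction hypothesis restricted to weightings not larger than the star-killed weighting. -/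
theorem coneLine_goodStep
    (hcone : ∀ (n : ℕ) (u : Sym2 (Fin n) → unitInterval) (A T : Finset (Fin n)) (b a₀ x : Fin n) (hb : b ∈ A),
      Disjoint T A → T.Nonempty → x ∉ A → x ∉ T → a₀ ∈ A → 4 ≤ A.card →
      (∀ a ∈ A, (prodBernoulli u).real (openConn a₀ b) ≤ (prodBernoulli u).real (openConn a b)) →
      (∀ v ∈ insert x T, (prodBernoulli u).real (openConn v b) < (prodBernoulli u).real (openConn a₀ b)) →
      (∀ w' : Sym2 (Fin n) → unitInterval,
        (Finset.univ.filter (fun v : Fin n => ∃ y : Fin n, 0 < (w' s(y, v) : ℝ))).card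
          ≤ (Finset.univ.filter (fun v : Fin n => ∃ y : Fin n, 0 < (u s(y, v) : ℝ))).card →
        ∀ (A' : Finset (Fin n)) (o' b' : Fin n), b' ∈ A' → o' ∉ A' →
        ∀ (t : ℝ) (sel : Finset (Fin n) → Fin n), (∀ W, sel W ∈ A') →
          (∀ a ∈ A', 1 - t ≤ (prodBernoulli w').real (openConn a b')) →
          (prodBernoulli w').real ((⋃ a ∈ A', openConn o' a) ∩ (openConn o' b')ᶜ)
            + ∑ W ∈ (Finset.univ : Finset (Finset (Fin n))).filter (fun W => o' ∈ W ∧ Disjoint W A'),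
                (prodBernoulli w').real {ω : BondConfig (Fin n) | openCluster ω o' = (W : Set (Fin n))}
                  * (prodBernoulli w').real (openConnIn ((W : Set (Fin n))ᶜ) (sel W) b')ᶜ
            ≤ t) →
      (prodBernoulli u).real (openConn a₀ b)
          + (prodBernoulli u).real ((openConn a₀ b)ᶜ ∩ (⋃ v ∈ T, openConn a₀ v) ∩ (⋃ v ∈ T, openConn v b))
        ≤ (prodBernoulli u).real (⋃ v ∈ T, openConn v b)
          + (∑ W ∈ (Finset.univ : Finset (Finset (Fin n))).filter (fun W => Disjoint W A),
              (prodBernoulli u).real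
                  {ω : BondConfig (Fin n) | ∀ z : Fin n, (z ∈ W ↔ ω ∈ ⋃ v ∈ T, openConn v z)}
                * A.inf' ⟨b, hb⟩ (fun a => (prodBernoulli u).real (openConnIn ((W : Set (Fin n))ᶜ) a b))) →
      (prodBernoulli u).real (openConn a₀ b)
          + (prodBernoulli u).real
              ((openConn a₀ b)ᶜ ∩ (⋃ v ∈ insert x T, openConn a₀ v) ∩ (⋃ v ∈ insert x T, openConn v b))
        ≤ (prodBernoulli u).real (⋃ v ∈ insert x T, openConn v b)
          + (∑ W ∈ (Finset.univ : Finset (Finset (Fin n))).filter (fun W => Disjoint W A),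
              (prodBernoulli u).real
                  {ω : BondConfig (Fin n) | ∀ z : Fin n, (z ∈ W ↔ ω ∈ ⋃ v ∈ insert x T, openConn v z)}
                * A.inf' ⟨b, hb⟩ (fun a => (prodBernoulli u).real (openConnIn ((W : Set (Fin n))ᶜ) a b)))) :
    ∀ (n : ℕ) (w : Sym2 (Fin n) → unitInterval) (A : Finset (Fin n)) (o b : Fin n),
      b ∈ A → o ∉ A →
      (∃ y : Fin n, y ∉ A ∧ y ≠ o ∧ (w s(o, y) : ℝ) ≠ 0) →
      (∀ w' : Sym2 (Fin n) → unitInterval,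
        (Finset.univ.filter (fun v : Fin n => ∃ u : Fin n, 0 < (w' s(u, v) : ℝ))).card
          < (Finset.univ.filter (fun v : Fin n => ∃ u : Fin n, 0 < (w s(u, v) : ℝ))).card →
        ∀ (A' : Finset (Fin n)) (o' b' : Fin n), b' ∈ A' → o' ∉ A' →
        ∀ (t : ℝ) (sel : Finset (Fin n) → Fin n), (∀ W, sel W ∈ A') →
          (∀ a ∈ A', 1 - t ≤ (prodBernoulli w').real (openConn a b')) →
          (prodBernoulli w').real ((⋃ a ∈ A', openConn o' a) ∩ (openConn o' b')ᶜ)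
            + ∑ W ∈ (Finset.univ : Finset (Finset (Fin n))).filter (fun W => o' ∈ W ∧ Disjoint W A'),
                (prodBernoulli w').real {ω : BondConfig (Fin n) | openCluster ω o' = (W : Set (Fin n))}
                  * (prodBernoulli w').real (openConnIn ((W : Set (Fin n))ᶜ) (sel W) b')ᶜ
            ≤ t) →
      ∀ (t : ℝ) (sel : Finset (Fin n) → Fin n), (∀ W, sel W ∈ A) →
        (∀ a ∈ A, 1 - t ≤ (prodBernoulli w).real (openConn a b)) →
        (prodBernoulli w).real ((⋃ a ∈ A, openConn o a) ∩ (openConn o b)ᶜ)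
          + ∑ W ∈ (Finset.univ : Finset (Finset (Fin n))).filter (fun W => o ∈ W ∧ Disjoint W A),
              (prodBernoulli w).real {ω : BondConfig (Fin n) | openCluster ω o = (W : Set (Fin n))}
                * (prodBernoulli w).real (openConnIn ((W : Set (Fin n))ᶜ) (sel W) b)ᶜ
          ≤ t := by
  intro n w A o b hb ho hlow IH
  obtain ⟨y₀, -, -, hy₀⟩ := id hlow
  refine goodStep24_main n w A o b hb ho hlow IH ?_
  intro S sel a₀ h2 hoS hSA hSw hsel ha₀ hmin hbad
  set K : Sym2 (Fin n) → unitInterval := fun e => if o ∈ e then (0 : unitInterval) else w e with hK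
  obtain ⟨s₀, hs₀⟩ := Finset.card_pos.1 (lt_of_lt_of_le zero_lt_two h2)
  rw [blockGrowth_glue_real_openConn, blockGrowth_glue_real_iUnion K S b]
  simp only [blockGrowth_glue_real_pocket K S]
  have hlt := goodStep_card_lt w hy₀
  have hIH : ∀ w' : Sym2 (Fin n) → unitInterval,
      (Finset.univ.filter (fun v : Fin n => ∃ y : Fin n, 0 < (w' s(y, v) : ℝ))).card
        ≤ (Finset.univ.filter (fun v : Fin n => ∃ y : Fin n, 0 < (K s(y, v) : ℝ))).card →
      ∀ (A' : Finset (Fin n)) (o' b' : Fin n), b' ∈ A' → o' ∉ A' →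
      ∀ (t : ℝ) (sel : Finset (Fin n) → Fin n), (∀ W, sel W ∈ A') →
        (∀ a ∈ A', 1 - t ≤ (prodBernoulli w').real (openConn a b')) →
        (prodBernoulli w').real ((⋃ a ∈ A', openConn o' a) ∩ (openConn o' b')ᶜ)
          + ∑ W ∈ (Finset.univ : Finset (Finset (Fin n))).filter (fun W => o' ∈ W ∧ Disjoint W A'),
              (prodBernoulli w').real {ω : BondConfig (Fin n) | openCluster ω o' = (W : Set (Fin n))}
                * (prodBernoulli w').real (openConnIn ((W : Set (Fin n))ᶜ) (sel W) b')ᶜ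
          ≤ t :=
    fun w' hw' => IH w' (lt_of_le_of_lt hw' hlt)
  exact coneLine_blockGood K A S b a₀ s₀ (fun W' => sel (insert o W')) hb (fun W' => hsel _) hSA hs₀ ha₀ hmin hbad
    hcone hIH

/-- **Every quadruple is good** from the cone stub: strong induction on the number of positive-degree vertices; base = the landed
`stub_goodBase` (with `stub_lemma5AnyRelay`), step = `coneLine_goodStep`. -/
theorem coneLine_good_all
    (hcone : ∀ (n : ℕ) (u : Sym2 (Fin n) → unitInterval) (A T : Finset (Fin n)) (b a₀ x : Fin n) (hb : b ∈ A),
      Disjoint T A → T.Nonempty → x ∉ A → x ∉ T → a₀ ∈ A → 4 ≤ A.card →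
      (∀ a ∈ A, (prodBernoulli u).real (openConn a₀ b) ≤ (prodBernoulli u).real (openConn a b)) →
      (∀ v ∈ insert x T, (prodBernoulli u).real (openConn v b) < (prodBernoulli u).real (openConn a₀ b)) →
      (∀ w' : Sym2 (Fin n) → unitInterval,
        (Finset.univ.filter (fun v : Fin n => ∃ y : Fin n, 0 < (w' s(y, v) : ℝ))).card
          ≤ (Finset.univ.filter (fun v : Fin n => ∃ y : Fin n, 0 < (u s(y, v) : ℝ))).card →
        ∀ (A' : Finset (Fin n)) (o' b' : Fin n), b' ∈ A' → o' ∉ A' →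
        ∀ (t : ℝ) (sel : Finset (Fin n) → Fin n), (∀ W, sel W ∈ A') →
          (∀ a ∈ A', 1 - t ≤ (prodBernoulli w').real (openConn a b')) →
          (prodBernoulli w').real ((⋃ a ∈ A', openConn o' a) ∩ (openConn o' b')ᶜ)
            + ∑ W ∈ (Finset.univ : Finset (Finset (Fin n))).filter (fun W => o' ∈ W ∧ Disjoint W A'),
                (prodBernoulli w').real {ω : BondConfig (Fin n) | openCluster ω o' = (W : Set (Fin n))}
                  * (prodBernoulli w').real (openConnIn ((W : Set (Fin n))ᶜ) (sel W) b')ᶜ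
            ≤ t) →
      (prodBernoulli u).real (openConn a₀ b)
          + (prodBernoulli u).real ((openConn a₀ b)ᶜ ∩ (⋃ v ∈ T, openConn a₀ v) ∩ (⋃ v ∈ T, openConn v b))
        ≤ (prodBernoulli u).real (⋃ v ∈ T, openConn v b)
          + (∑ W ∈ (Finset.univ : Finset (Finset (Fin n))).filter (fun W => Disjoint W A),
              (prodBernoulli u).real
                  {ω : BondConfig (Fin n) | ∀ z : Fin n, (z ∈ W ↔ ω ∈ ⋃ v ∈ T, openConn v z)}
                * A.inf' ⟨b, hb⟩ (fun a => (prodBernoulli u).real (openConnIn ((W : Set (Fin n))ᶜ) a b))) →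
      (prodBernoulli u).real (openConn a₀ b)
          + (prodBernoulli u).real
              ((openConn a₀ b)ᶜ ∩ (⋃ v ∈ insert x T, openConn a₀ v) ∩ (⋃ v ∈ insert x T, openConn v b))
        ≤ (prodBernoulli u).real (⋃ v ∈ insert x T, openConn v b)
          + (∑ W ∈ (Finset.univ : Finset (Finset (Fin n))).filter (fun W => Disjoint W A),
              (prodBernoulli u).real
                  {ω : BondConfig (Fin n) | ∀ z : Fin n, (z ∈ W ↔ ω ∈ ⋃ v ∈ insert x T, openConn v z)}
                * A.inf' ⟨b, hb⟩ (fun a => (prodBernoulli u).real (openConnIn ((W : Set (Fin n))ᶜ) a b))))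
    (n : ℕ) :
    ∀ (w : Sym2 (Fin n) → unitInterval) (A : Finset (Fin n)) (o b : Fin n),
      b ∈ A → o ∉ A →
      ∀ (t : ℝ) (sel : Finset (Fin n) → Fin n), (∀ W, sel W ∈ A) →
        (∀ a ∈ A, 1 - t ≤ (prodBernoulli w).real (openConn a b)) →
        (prodBernoulli w).real ((⋃ a ∈ A, openConn o a) ∩ (openConn o b)ᶜ)
          + ∑ W ∈ (Finset.univ : Finset (Finset (Fin n))).filter (fun W => o ∈ W ∧ Disjoint W A),
              (prodBernoulli w).real {ω : BondConfig (Fin n) | openCluster ω o = (W : Set (Fin n))}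
                * (prodBernoulli w).real (openConnIn ((W : Set (Fin n))ᶜ) (sel W) b)ᶜ
          ≤ t := by
  suffices h : ∀ (k : ℕ) (w : Sym2 (Fin n) → unitInterval),
      (Finset.univ.filter (fun v : Fin n => ∃ u : Fin n, 0 < (w s(u, v) : ℝ))).card = k →
      ∀ (A : Finset (Fin n)) (o b : Fin n),
      b ∈ A → o ∉ A →
      ∀ (t : ℝ) (sel : Finset (Fin n) → Fin n), (∀ W, sel W ∈ A) →
        (∀ a ∈ A, 1 - t ≤ (prodBernoulli w).real (openConn a b)) →
        (prodBernoulli w).real ((⋃ a ∈ A, openConn o a) ∩ (openConn o b)ᶜ)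
          + ∑ W ∈ (Finset.univ : Finset (Finset (Fin n))).filter (fun W => o ∈ W ∧ Disjoint W A),
              (prodBernoulli w).real {ω : BondConfig (Fin n) | openCluster ω o = (W : Set (Fin n))}
                * (prodBernoulli w).real (openConnIn ((W : Set (Fin n))ᶜ) (sel W) b)ᶜ
          ≤ t by
    intro w A o b hb ho
    exact h _ w rfl A o b hb ho
  intro k
  induction k using Nat.strong_induction_on with
  | _ k ih =>
    intro w hk A o b hb ho
    by_cases hiso : ∀ y : Fin n, y ∉ A → y ≠ o → (w s(o, y) : ℝ) = 0
    · exact stub_goodBase stub_lemma5AnyRelay n w A o b hb ho hiso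
    · push Not at hiso
      refine coneLine_goodStep hcone n w A o b hb ho hiso ?_
      intro w' hw' A' o' b' hb' ho'
      exact ih _ (hk ▸ hw') w' rfl A' o' b' hb' ho'

/-- **`AdditiveGluing` (its statement, verbatim) from the cone stub**: KN's level-set normal form (as in v1/v2). -/
theorem coneLine_additiveGluing_of
    (hcone : ∀ (n : ℕ) (u : Sym2 (Fin n) → unitInterval) (A T : Finset (Fin n)) (b a₀ x : Fin n) (hb : b ∈ A),
      Disjoint T A → T.Nonempty → x ∉ A → x ∉ T → a₀ ∈ A → 4 ≤ A.card →
      (∀ a ∈ A, (prodBernoulli u).real (openConn a₀ b) ≤ (prodBernoulli u).real (openConn a b)) →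
      (∀ v ∈ insert x T, (prodBernoulli u).real (openConn v b) < (prodBernoulli u).real (openConn a₀ b)) →
      (∀ w' : Sym2 (Fin n) → unitInterval,
        (Finset.univ.filter (fun v : Fin n => ∃ y : Fin n, 0 < (w' s(y, v) : ℝ))).card
          ≤ (Finset.univ.filter (fun v : Fin n => ∃ y : Fin n, 0 < (u s(y, v) : ℝ))).card →
        ∀ (A' : Finset (Fin n)) (o' b' : Fin n), b' ∈ A' → o' ∉ A' →
        ∀ (t : ℝ) (sel : Finset (Fin n) → Fin n), (∀ W, sel W ∈ A') →
          (∀ a ∈ A', 1 - t ≤ (prodBernoulli w').real (openConn a b')) →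
          (prodBernoulli w').real ((⋃ a ∈ A', openConn o' a) ∩ (openConn o' b')ᶜ)
            + ∑ W ∈ (Finset.univ : Finset (Finset (Fin n))).filter (fun W => o' ∈ W ∧ Disjoint W A'),
                (prodBernoulli w').real {ω : BondConfig (Fin n) | openCluster ω o' = (W : Set (Fin n))}
                  * (prodBernoulli w').real (openConnIn ((W : Set (Fin n))ᶜ) (sel W) b')ᶜ
            ≤ t) →
      (prodBernoulli u).real (openConn a₀ b)
          + (prodBernoulli u).real ((openConn a₀ b)ᶜ ∩ (⋃ v ∈ T, openConn a₀ v) ∩ (⋃ v ∈ T, openConn v b))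
        ≤ (prodBernoulli u).real (⋃ v ∈ T, openConn v b)
          + (∑ W ∈ (Finset.univ : Finset (Finset (Fin n))).filter (fun W => Disjoint W A),
              (prodBernoulli u).real
                  {ω : BondConfig (Fin n) | ∀ z : Fin n, (z ∈ W ↔ ω ∈ ⋃ v ∈ T, openConn v z)}
                * A.inf' ⟨b, hb⟩ (fun a => (prodBernoulli u).real (openConnIn ((W : Set (Fin n))ᶜ) a b))) →
      (prodBernoulli u).real (openConn a₀ b)
          + (prodBernoulli u).real
              ((openConn a₀ b)ᶜ ∩ (⋃ v ∈ insert x T, openConn a₀ v) ∩ (⋃ v ∈ insert x T, openConn v b))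
        ≤ (prodBernoulli u).real (⋃ v ∈ insert x T, openConn v b)
          + (∑ W ∈ (Finset.univ : Finset (Finset (Fin n))).filter (fun W => Disjoint W A),
              (prodBernoulli u).real
                  {ω : BondConfig (Fin n) | ∀ z : Fin n, (z ∈ W ↔ ω ∈ ⋃ v ∈ insert x T, openConn v z)}
                * A.inf' ⟨b, hb⟩ (fun a => (prodBernoulli u).real (openConnIn ((W : Set (Fin n))ᶜ) a b)))) :
    ∀ (n : ℕ) (w : Sym2 (Fin n) → unitInterval) (A : Finset (Fin n)) (o b : Fin n) (t : ℝ), 0 ≤ t →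
      (∀ a ∈ A, 1 - t ≤ (prodBernoulli w).real (openConn a b)) →
      (prodBernoulli w).real (⋃ a ∈ A, openConn o a) - t ≤ (prodBernoulli w).real (openConn o b) := by
  intro n w A o b t ht hA
  have hU1 : (prodBernoulli w).real (⋃ a ∈ A, (openConn o a : Set (BondConfig (Fin n)))) ≤ 1 :=
    measureReal_le_one
  have hob0 : 0 ≤ (prodBernoulli w).real (openConn o b : Set (BondConfig (Fin n))) := measureReal_nonneg
  by_cases ht1 : 1 ≤ t
  · linarith
  push Not at ht1
  have hbb : (prodBernoulli w).real (openConn b b : Set (BondConfig (Fin n))) = 1 := by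
    have h : (openConn b b : Set (BondConfig (Fin n))) = Set.univ :=
      Set.eq_univ_of_forall fun ω => (SimpleGraph.Reachable.refl b : (openGraph ω).Reachable b b)
    rw [h, probReal_univ]
  have hbA' : b ∈ Finset.univ.filter (fun x : Fin n => 1 - t ≤ (prodBernoulli w).real (openConn x b)) := by
    rw [Finset.mem_filter]
    refine ⟨Finset.mem_univ _, ?_⟩
    rw [hbb]
    linarith
  have hAA' : ∀ a ∈ A, a ∈ Finset.univ.filter (fun x : Fin n => 1 - t ≤ (prodBernoulli w).real (openConn x b)) :=
    fun a ha => by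
      rw [Finset.mem_filter]
      exact ⟨Finset.mem_univ _, hA a ha⟩
  have hmemA' : ∀ x ∈ Finset.univ.filter (fun x : Fin n => 1 - t ≤ (prodBernoulli w).real (openConn x b)),
      1 - t ≤ (prodBernoulli w).real (openConn x b) := fun x hx => by
    rw [Finset.mem_filter] at hx
    exact hx.2
  by_cases ho : o ∈ Finset.univ.filter (fun x : Fin n => 1 - t ≤ (prodBernoulli w).real (openConn x b))
  · have := hmemA' o ho
    linarith
  have hgood := coneLine_good_all hcone n w
    (Finset.univ.filter (fun x : Fin n => 1 - t ≤ (prodBernoulli w).real (openConn x b))) o b hbA' ho t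
    (fun _ => b) (fun _ => hbA') hmemA'
  have hsum : 0 ≤ ∑ W ∈ (Finset.univ : Finset (Finset (Fin n))).filter (fun W => o ∈ W ∧
      Disjoint W (Finset.univ.filter (fun x : Fin n => 1 - t ≤ (prodBernoulli w).real (openConn x b)))),
        (prodBernoulli w).real {ω : BondConfig (Fin n) | openCluster ω o = (W : Set (Fin n))}
          * (prodBernoulli w).real (openConnIn ((W : Set (Fin n))ᶜ) ((fun _ => b) W) b)ᶜ :=
    Finset.sum_nonneg fun W _ => mul_nonneg measureReal_nonneg measureReal_nonneg
  have hlive : (prodBernoulli w).real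
      ((⋃ a ∈ Finset.univ.filter (fun x : Fin n => 1 - t ≤ (prodBernoulli w).real (openConn x b)),
        (openConn o a : Set (BondConfig (Fin n)))) ∩ (openConn o b)ᶜ) ≤ t := by
    linarith
  have hsub : (⋃ a ∈ A, (openConn o a : Set (BondConfig (Fin n)))) ⊆
      ((⋃ a ∈ Finset.univ.filter (fun x : Fin n => 1 - t ≤ (prodBernoulli w).real (openConn x b)),
        (openConn o a : Set (BondConfig (Fin n)))) ∩ (openConn o b)ᶜ) ∪ openConn o b := by
    intro ω hω
    by_cases hb : ω ∈ openConn o b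
    · exact Or.inr hb
    · refine Or.inl ⟨?_, hb⟩
      simp only [Set.mem_iUnion] at hω ⊢
      obtain ⟨a, ha, hωa⟩ := hω
      exact ⟨a, hAA' a ha, hωa⟩
  have hfin := (measureReal_mono (μ := prodBernoulli w) hsub).trans (measureReal_union_le _ _)
  linarith

/-- **Skeleton v2's stub `stub_pairGamma` (the RATIO form) implies the cone stub** — so a proof of `pairGamma` still closes the
crux through this skeleton.  Real proof: the landed conditional chain `peelLine_blockGood` (pair step + gluing transfer +
`stub_goodStaysGoodBlock_var22625`) run on the block `T ∪ {x}` from the point `s ∈ T`, whose goodness the induction hypothesis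
supplies; the worst selection is realised by a minimising selection. [cite: KozmaNitzan2024, §3.2 pp. 12–14] -/
theorem coneLine_of_pairGamma
    (hR : ∀ (n : ℕ) (u : Sym2 (Fin n) → unitInterval) (A T : Finset (Fin n)) (b a₀ x s : Fin n) (hb : b ∈ A), Disjoint T A → x ∉ A → x ∉ T → a₀ ∈ A → s ∈ T → (∀ a ∈ A, (prodBernoulli u).real (openConn a₀ b) ≤ (prodBernoulli u).real (openConn a b)) → (prodBernoulli u).real (⋃ v ∈ T, openConn v b) < (prodBernoulli u).real (openConn a₀ b) + (prodBernoulli u).real ((openConn a₀ b)ᶜ ∩ (⋃ v ∈ T, openConn a₀ v) ∩ (⋃ v ∈ T, openConn v b)) → ((prodBernoulli (fun e : Sym2 (Fin n) => if (∀ y ∈ e, y ∈ T) ∧ ¬ e.IsDiag then 1 else u e)).real (openConn s b) + (∑ W ∈ (Finset.univ : Finset (Finset (Fin n))).filter (fun W => s ∈ W ∧ Disjoint W A), (prodBernoulli (fun e : Sym2 (Fin n) => if (∀ y ∈ e, y ∈ T) ∧ ¬ e.IsDiag then 1 else u e)).real {ω : BondConfig (Fin n) | openCluster ω s = (W : Set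 (Fin n))} * A.inf' ⟨b, hb⟩ (fun a => (prodBernoulli (fun e : Sym2 (Fin n) => if (∀ y ∈ e, y ∈ T) ∧ ¬ e.IsDiag then 1 else u e)).real (openConnIn ((W : Set (Fin n))ᶜ) a b))) - (prodBernoulli (fun e : Sym2 (Fin n) => if (∀ y ∈ e, y ∈ T) ∧ ¬ e.IsDiag then 1 else u e)).real (openConn a₀ b)) * (∑ W ∈ (Finset.univ : Finset (Finset (Fin n))).filter (fun W => Disjoint W A), (prodBernoulli (fun e : Sym2 (Fin n) => if (∀ y ∈ e, y ∈ T) ∧ ¬ e.IsDiag then 1 else u e)).real {ω : BondConfig (Fin n) | ∀ z : Fin n, (z ∈ W ↔ ω ∈ ⋃ v ∈ ({s, x} : Finset (Fin n)), openConn v z)} * A.inf' ⟨b, hb⟩ (fun a => (prodBernoulli (fun e : Sym2 (Fin n) => if (∀ y ∈ e, y ∈ T) ∧ ¬ e.IsDiag then 1 else u e)).real (openConnIn ((W : Set (Fin n))ᶜ) a b))) ≤ ((prodBernoulli (fun e : Sym2 (Fin n) => if (∀ y ∈ e, y ∈ T) ∧ ¬ e.IsDiag then 1 else u e)).real (⋃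 v ∈ ({s, x} : Finset (Fin n)), openConn v b) + (∑ W ∈ (Finset.univ : Finset (Finset (Fin n))).filter (fun W => Disjoint W A), (prodBernoulli (fun e : Sym2 (Fin n) => if (∀ y ∈ e, y ∈ T) ∧ ¬ e.IsDiag then 1 else u e)).real {ω : BondConfig (Fin n) | ∀ z : Fin n, (z ∈ W ↔ ω ∈ ⋃ v ∈ ({s, x} : Finset (Fin n)), openConn v z)} * A.inf' ⟨b, hb⟩ (fun a => (prodBernoulli (fun e : Sym2 (Fin n) => if (∀ y ∈ e, y ∈ T) ∧ ¬ e.IsDiag then 1 else u e)).real (openConnIn ((W : Set (Fin n))ᶜ) a b))) - (prodBernoulli (fun e : Sym2 (Fin n) => if (∀ y ∈ e, y ∈ T) ∧ ¬ e.IsDiag then 1 else u e)).real (openConn a₀ b) - (prodBernoulli (fun e : Sym2 (Fin n) => if (∀ y ∈ e, y ∈ T) ∧ ¬ e.IsDiag then 1 else u e)).real ((openConn a₀ b)ᶜ ∩ (⋃ v ∈ ({s, x} : Finset (Fin n)), openConn a₀ v) ∩ (⋃ v ∈ ({s, x} : Finset (Fin n)), openConn v b))) * (∑ W ∈ (Finset.univ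 : Finset (Finset (Fin n))).filter (fun W => s ∈ W ∧ Disjoint W A), (prodBernoulli (fun e : Sym2 (Fin n) => if (∀ y ∈ e, y ∈ T) ∧ ¬ e.IsDiag then 1 else u e)).real {ω : BondConfig (Fin n) | openCluster ω s = (W : Set (Fin n))} * A.inf' ⟨b, hb⟩ (fun a => (prodBernoulli (fun e : Sym2 (Fin n) => if (∀ y ∈ e, y ∈ T) ∧ ¬ e.IsDiag then 1 else u e)).real (openConnIn ((W : Set (Fin n))ᶜ) a b)))) :
    ∀ (n : ℕ) (u : Sym2 (Fin n) → unitInterval) (A T : Finset (Fin n)) (b a₀ x : Fin n) (hb : b ∈ A),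
      Disjoint T A → T.Nonempty → x ∉ A → x ∉ T → a₀ ∈ A → 4 ≤ A.card →
      (∀ a ∈ A, (prodBernoulli u).real (openConn a₀ b) ≤ (prodBernoulli u).real (openConn a b)) →
      (∀ v ∈ insert x T, (prodBernoulli u).real (openConn v b) < (prodBernoulli u).real (openConn a₀ b)) →
      (∀ w' : Sym2 (Fin n) → unitInterval,
        (Finset.univ.filter (fun v : Fin n => ∃ y : Fin n, 0 < (w' s(y, v) : ℝ))).card
          ≤ (Finset.univ.filter (fun v : Fin n => ∃ y : Fin n, 0 < (u s(y, v) : ℝ))).card →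
        ∀ (A' : Finset (Fin n)) (o' b' : Fin n), b' ∈ A' → o' ∉ A' →
        ∀ (t : ℝ) (sel : Finset (Fin n) → Fin n), (∀ W, sel W ∈ A') →
          (∀ a ∈ A', 1 - t ≤ (prodBernoulli w').real (openConn a b')) →
          (prodBernoulli w').real ((⋃ a ∈ A', openConn o' a) ∩ (openConn o' b')ᶜ)
            + ∑ W ∈ (Finset.univ : Finset (Finset (Fin n))).filter (fun W => o' ∈ W ∧ Disjoint W A'),
                (prodBernoulli w').real {ω : BondConfig (Fin n) | openCluster ω o' = (W : Set (Fin n))}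
                  * (prodBernoulli w').real (openConnIn ((W : Set (Fin n))ᶜ) (sel W) b')ᶜ
            ≤ t) →
      (prodBernoulli u).real (openConn a₀ b)
          + (prodBernoulli u).real ((openConn a₀ b)ᶜ ∩ (⋃ v ∈ T, openConn a₀ v) ∩ (⋃ v ∈ T, openConn v b))
        ≤ (prodBernoulli u).real (⋃ v ∈ T, openConn v b)
          + (∑ W ∈ (Finset.univ : Finset (Finset (Fin n))).filter (fun W => Disjoint W A),
              (prodBernoulli u).real
                  {ω : BondConfig (Fin n) | ∀ z : Fin n, (z ∈ W ↔ ω ∈ ⋃ v ∈ T, openConn v z)}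
                * A.inf' ⟨b, hb⟩ (fun a => (prodBernoulli u).real (openConnIn ((W : Set (Fin n))ᶜ) a b))) →
      (prodBernoulli u).real (openConn a₀ b)
          + (prodBernoulli u).real
              ((openConn a₀ b)ᶜ ∩ (⋃ v ∈ insert x T, openConn a₀ v) ∩ (⋃ v ∈ insert x T, openConn v b))
        ≤ (prodBernoulli u).real (⋃ v ∈ insert x T, openConn v b)
          + (∑ W ∈ (Finset.univ : Finset (Finset (Fin n))).filter (fun W => Disjoint W A),
              (prodBernoulli u).real
                  {ω : BondConfig (Fin n) | ∀ z : Fin n, (z ∈ W ↔ ω ∈ ⋃ v ∈ insert x T, openConn v z)}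
                * A.inf' ⟨b, hb⟩ (fun a => (prodBernoulli u).real (openConnIn ((W : Set (Fin n))ᶜ) a b))) := by
  intro n u A T b a₀ x hb hTA hT hxA hxT ha₀ _ hmin hbad hIH _
  obtain ⟨s, hs⟩ := hT
  have hsA : s ∉ A := Finset.disjoint_left.1 hTA hs
  have hSA : Disjoint (insert x T) A := by
    rw [Finset.disjoint_insert_left]
    exact ⟨hxA, hTA⟩
  have hs' : s ∈ insert x T := Finset.mem_insert_of_mem hs
  have h2 : 2 ≤ (insert x T).card := by
    rw [Finset.card_insert_of_notMem hxT]
    have : 0 < T.card := Finset.card_pos.2 ⟨s, hs⟩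
    omega
  -- a selection realising the worst case
  have hex : ∀ W : Finset (Fin n), ∃ a, a ∈ A ∧
      A.inf' ⟨b, hb⟩ (fun a => (prodBernoulli u).real (openConnIn ((W : Set (Fin n))ᶜ) a b)) =
        (prodBernoulli u).real (openConnIn ((W : Set (Fin n))ᶜ) a b) :=
    fun W => Finset.exists_mem_eq_inf' ⟨b, hb⟩ _
  choose selm hselmA hselm using hex
  have hgood := hIH u le_rfl A s b hb hsA
  have key := peelLine_blockGood u A (insert x T) b a₀ s selm hb hselmA hSA hs' h2 ha₀ hmin hbad hR hgood
  have hsum : ∑ W ∈ (Finset.univ : Finset (Finset (Fin n))).filter (fun W => Disjoint W A),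
      (prodBernoulli u).real {ω : BondConfig (Fin n) | ∀ z : Fin n, (z ∈ W ↔ ω ∈ ⋃ v ∈ insert x T, openConn v z)}
        * (prodBernoulli u).real (openConnIn ((W : Set (Fin n))ᶜ) (selm W) b)
      = ∑ W ∈ (Finset.univ : Finset (Finset (Fin n))).filter (fun W => Disjoint W A),
          (prodBernoulli u).real {ω : BondConfig (Fin n) | ∀ z : Fin n, (z ∈ W ↔ ω ∈ ⋃ v ∈ insert x T, openConn v z)}
            * A.inf' ⟨b, hb⟩ (fun a => (prodBernoulli u).real (openConnIn ((W : Set (Fin n))ᶜ) a b)) := by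
    refine Finset.sum_congr rfl fun W _ => ?_
    rw [hselm W]
  rw [hsum] at key
  exact key


/-- Registered stub `stub_additiveGluingOfConePeel_c5` of crux stmt-CriticalPhenomena-4576 (lead c5, line `peel`, skeleton v3):
**the crux `AdditiveGluing` BY NAME from the CONE growth step** (fully spelled statement). [cite: KozmaNitzan2024, §3.2 pp. 12–14] -/
theorem stub_additiveGluingOfConePeel_c5 : (∀ (n : ℕ) (u : Sym2 (Fin n) → unitInterval) (A T : Finset (Fin n)) (b a₀ x : Fin n) (hb : b ∈ A), Disjoint T A → T.Nonempty → x ∉ A → x ∉ T → a₀ ∈ A → 4 ≤ A.card → (∀ a ∈ A, (prodBernoulli u).real (openConn a₀ b) ≤ (prodBernoulli u).real (openConn a b)) → (∀ v ∈ insert x T, (prodBernoulli u).real (openConn v b) < (prodBernoulli u).real (openConn a₀ b)) → (∀ w' : Sym2 (Fin n) → unitInterval, (Finset.univ.filter (fun v : Fin n => ∃ y : Fin n, 0 < (w' s(y, v) : ℝ))).card ≤ (Finset.univ.filter (fun v : Fin n => ∃ y : Fin n, 0 < (u s(y, v) : ℝ))).card → ∀ (A' : Finset (Fin n)) (o' b'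 : Fin n), b' ∈ A' → o' ∉ A' → ∀ (t : ℝ) (sel : Finset (Fin n) → Fin n), (∀ W, sel W ∈ A') → (∀ a ∈ A', 1 - t ≤ (prodBernoulli w').real (openConn a b')) → (prodBernoulli w').real ((⋃ a ∈ A', openConn o' a) ∩ (openConn o' b')ᶜ) + ∑ W ∈ (Finset.univ : Finset (Finset (Fin n))).filter (fun W => o' ∈ W ∧ Disjoint W A'), (prodBernoulli w').real {ω : BondConfig (Fin n) | openCluster ω o' = (W : Set (Fin n))} * (prodBernoulli w').real (openConnIn ((W : Set (Fin n))ᶜ) (sel W) b')ᶜ ≤ t) → (prodBernoulli u).real (openConn a₀ b) + (prodBernoulli u).real ((openConn a₀ b)ᶜ ∩ (⋃ v ∈ T, openConn a₀ v) ∩ (⋃ v ∈ T, openConn v b)) ≤ (prodBernoulli u).real (⋃ v ∈ T, openConn v b) + (∑ W ∈ (Finset.univ : Finset (Finset (Fin n))).filter (fun W => Disjoint W A), (prodBernoulli u).real {ω : BondConfig (Fin n) | ∀ z : Fin n, (z ∈ W ↔ ω ∈ ⋃ v ∈ T, openConn v z)} * A.inf' ⟨b, hb⟩ (fun a => (prodBernoulli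 u).real (openConnIn ((W : Set (Fin n))ᶜ) a b))) → (prodBernoulli u).real (openConn a₀ b) + (prodBernoulli u).real ((openConn a₀ b)ᶜ ∩ (⋃ v ∈ insert x T, openConn a₀ v) ∩ (⋃ v ∈ insert x T, openConn v b)) ≤ (prodBernoulli u).real (⋃ v ∈ insert x T, openConn v b) + (∑ W ∈ (Finset.univ : Finset (Finset (Fin n))).filter (fun W => Disjoint W A), (prodBernoulli u).real {ω : BondConfig (Fin n) | ∀ z : Fin n, (z ∈ W ↔ ω ∈ ⋃ v ∈ insert x T, openConn v z)} * A.inf' ⟨b, hb⟩ (fun a => (prodBernoulli u).real (openConnIn ((W : Set (Fin n))ᶜ) a b)))) → Summit.CriticalPhenomena.PercolationContinuityZ3.Theses.PercNearOneGluing.AdditiveGluing :=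
  fun hcone => coneLine_additiveGluing_of hcone

end

end Summit.CriticalPhenomena.PercolationContinuityZ3.Theorems
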